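import Summits.HodgeConjecture.HodgeConjecture.Theorems.CyclicUnitaryPowersPLPackageOfLocalMonodromyBound
import Summits.HodgeConjecture.HodgeConjecture.Theorems.CyclicUnitaryPowersCyclicSurfacePowersHodge
import Summits.HodgeConjecture.HodgeConjecture.Theorems.SmoothHypersurfaceGeometricGenus
import Literature.AlgebraicGeometry.HodgeTheory.SmoothSurfaceSecondBettiNumber
import HarnessLib

/-!
# Route `CyclicUnitaryPowers` — the CATTANI–DELIGNE–KAPLAN-FREE core of crux K1-A and of the rung-F-H1 leaf:
# deck-unitary commutators lie in the Hodge group, and the Hodge conjecture holds on all powers, for every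
# HODGE-GENERIC smooth `p`-cyclic surface (`p ≥ 7` prime)

Crux K1-A (`VeryGeneralDeckCommutatorsInHg`, stmt-HodgeConjecture-19544) is, at registry v17, conditional on exactly two
cited facts: F1‡ (`carlsonToledo1999_nodalMeridianLocalMonodromyBound`, seat Ax's programme) and CDK
(`cmsp_nonHodgeGenericPoints_countable_algebraic_cover`, Cattani–Deligne–Kaplan 1995).  CDK enters the landed composition
(`CyclicUnitaryPowersK1OfPrintNumbers.veryGeneralDeckCommutatorsInHg_of_deckHodge_prime`) at ONE line only: «the
classifying point of a very general member is Hodge generic».  Everything downstream is a statement about a single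
Hodge-generic point of the Carlson–Toledo family.  This file isolates that statement:

* `deck_comm_model_of_hodgeGeneric` — **fact-free per-point core**: for any Carlson–Toledo structure
  `𝔉 : CarlsonToledoFamily p` (`p ≥ 7` prime), any non-zero ternary `p`-form `f` with smooth cyclic cover and any
  family of Hodge-symmetric models in which the classifying point `𝔉.pt f` is Hodge generic
  (`IsHodgeGenericPoint`, CMSP Def. 15.3.5), the model `X_F = V(x₃^p − f)` with its deck transformation satisfies the
  route's clauses `Deck ∧ Comm` — CMSP 15.3.7 (i) is the tree THEOREM
  `deligne_finiteIndex_monodromy_le_mumfordTateGroup_of_isQuasiProjectiveOver`, the density input is the PROVED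
  `carlsonToledo1999_unitaryReflection_zariskiDense_holds`, the eigen-Hodge clauses come from the PROVED print numbers
  (`Arapura2012_hypersurface_geometricGenus_holds`, `EisenbudHarris2016_surface_secondBettiNumber_holds`);
* `exists_deck_comm_of_hodgeGeneric` — the same for every `X` cut out in `ℙ³` by `x₃^p − f` (model transfer);
* `hodgeConjectureFor_powers_of_hodgeGeneric` — **fact-free**: for such `𝔉`, `f`, `X`, every self fibre power `Y` of
  `X` satisfies `HodgeConjectureFor (2(k+1)) Y` (crux K2 `powersHodgeOfDeckCommutators` and support S
  `detSupportsBalanced_holds`, both PROVED);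
* `exists_deck_comm_of_hodgeGeneric_of_localMonodromyBound`, `hodgeConjectureFor_powers_of_hodgeGeneric_of_localMonodromyBound`
  — the same two conclusions for the CONSTRUCTED family `cyclicCoverFamily p` (classifying point `cyclicCoverPoint p f`),
  CONDITIONAL on F1‡ alone (which supplies the Carlson–Toledo structure on that family,
  `CyclicUnitaryPowersPLPackageOfLocalMonodromyBound.exists_cyclicReflectionSystem_of_localMonodromyBound`, built in place
  with the constructed family as its fields so that Hodge-genericity is stated on `cyclicCoverFamily p` itself).

So the rung-F-H1 content of the route splits as: (HC on all powers of every HODGE-GENERIC `p`-cyclic surface) ⟸ F1‡,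
NO Cattani–Deligne–Kaplan; and CDK is used only to pass from «Hodge generic» to the polynomial «very general» of the
typed leaf `CyclicSurfacePowersHodge`.  Honest framing: CONDITIONAL on F1‡ (the last two theorems) resp. on the
structure hypothesis `𝔉` (the first three); item stmt-HodgeConjecture-19544 stays OPEN; rung F-H1 not moved; nothing
here says HC ∕ HC_AV is proved.  Written by the prover seat `hodge-nonav-prover-Bx` (g12).

## References
* [CarlsonToledo1999] J. A. Carlson, D. Toledo, Discriminant complements and kernels of monodromy representations,
  Duke Math. J. 97 (1999), §§2, 5, 6, 7 (Thm. 7.1).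
* [CarlsonMullerStachPeters2017] J. Carlson, S. Müller-Stach, C. Peters, Period Mappings and Period Domains, 2nd ed.,
  CUP 2017, Def. 15.3.5, Lemma–Definition 15.3.7.
* [Deligne1972WeilK3] P. Deligne, La conjecture de Weil pour les surfaces K3, Invent. Math. 15 (1972), Prop. 7.5.
* [CattaniDeligneKaplan1995] E. Cattani, P. Deligne, A. Kaplan, On the locus of Hodge classes, JAMS 8 (1995) — NOT used here.
* [RamonMari2008] J. J. Ramón Marí, the K3 precedent of K2.
-/

noncomputable section

set_option linter.dupNamespace false

namespace Summit.HodgeConjecture.HodgeConjecture.Theorems.CyclicUnitaryPowersHodgeGenericDeckCommutators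

open Literature.AlgebraicGeometry.Motives Literature.AlgebraicGeometry.HodgeTheory
open Literature.AlgebraicGeometry.HodgeTheory.BettiUniverse
open Literature.AlgebraicGeometry.Motives.UniversalHypersurface Literature.AlgebraicGeometry.HodgeTheory.UniversalHypersurface
open Literature.AlgebraicTopology.SingularHomology
open CategoryTheory CategoryTheory.Limits
open Summit.HodgeConjecture.HodgeConjecture.Theorems.CyclicUnitaryPowersDeckModelClauses
open Summit.HodgeConjecture.HodgeConjecture.Theorems.CyclicUnitaryPowersK1OfPrintNumbers
open Summit.HodgeConjecture.HodgeConjecture.Theorems.CyclicUnitaryPowersModelTransfer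
open Summit.HodgeConjecture.HodgeConjecture.Theorems.SmoothHypersurfaceGeometricGenus (Arapura2012_hypersurface_geometricGenus_holds)
open Summit.HodgeConjecture.HodgeConjecture.Theses.CyclicUnitaryPowers

/-! ### §1 The per-point core at a Hodge-generic point of a Carlson–Toledo structure (fact-free) -/

/-- **Deck clauses and deck-unitary commutators in the Hodge group at a HODGE-GENERIC point — fact-free core.**  Let
`p ≥ 7` be prime, `𝔉 : CarlsonToledoFamily p` a Carlson–Toledo structure (the universal family of smooth `p`-cyclic
covers of the plane with its Picard–Lefschetz package), `f ≠ 0` a ternary `p`-form with smooth model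
`X_F = V(x₃^p − f) ⊂ ℙ³`, and `A` a family of Hodge-symmetric Hodge models of the fibres in which the classifying point
`𝔉.pt f` is Hodge generic (`IsHodgeGenericPoint`: every weight-`0` rational Hodge tensor of `H²(𝒴_{pt f})` stays Hodge
under every rational transport).  Then the deck transformation `σ_F : x₃ ↦ e^{2πi/p} x₃` of `X_F` satisfies the route's
clauses `Deck` ((o)–(ii) `exists_cyclicDeckModel_clauses_one_two`; (iii)–(iv) `cyclicDeckHodge_of_printNumbers` fed with
the PROVED geometric genus and `b₂`) and `Comm`: by CMSP 15.3.7 (i) — the tree theorem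
`deligne_finiteIndex_monodromy_le_mumfordTateGroup_of_isQuasiProjectiveOver` — a finite-index subgroup `Γ'` of the
monodromy group lies in `MT(H²)`; the commutator of two transported deck-unitary automorphisms lies in
`(⁅Γ', Γ'⁆)^Zar(ℚ)` (`unitaryReflectionDensity_of_CT71` with the PROVED Carlson–Toledo density theorem), hence in the
Hodge group (`mem_hodgeGroup_of_mem_glZariskiClosure_commutator`, polarizable fibre); transport back along the envelope
kit.  No Cattani–Deligne–Kaplan.  [cite: CarlsonMullerStachPeters2017, Definition 15.3.5 and Lemma–Definition 15.3.7]
[cite: CarlsonToledo1999, §7 Theorem 7.1] [cite: Deligne1972WeilK3, Prop. 7.5] -/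
theorem deck_comm_model_of_hodgeGeneric {p : ℕ} (hp : p.Prime) (h7 : 7 ≤ p) (𝔉 : CarlsonToledoFamily p)
    (f : MvPolynomial (Fin 3) ℂ) (hf : f.IsHomogeneous p) (hf0 : f ≠ 0)
    (hXF : IsSmoothProjective 2 (SmoothHypersurface.hypersurface
      (MvPolynomial.X (Fin.last 3) ^ p - MvPolynomial.rename Fin.castSucc f)))
    (ha : (fun i : Fin 4 => if i = Fin.last 3 then
        (Units.mk0 (Complex.exp (2 * (Real.pi : ℂ) * Complex.I / (p : ℂ))) (Complex.exp_ne_zero _)) else 1) ∈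
      diagonalStabilizer (MvPolynomial.X (Fin.last 3) ^ p - MvPolynomial.rename Fin.castSucc f))
    (A : ∀ t : ComplexPoints 𝔉.S, HodgeModel 2 (fiberOver 𝔉.u t)) (hA : ∀ t, (A t).IsHodgeSymmetric)
    (hsgen : haveI : HodgeTensorFacts.{0, 0} := hodgeTensorFacts_holds
      haveI : ∀ t : ComplexPoints 𝔉.S, Module.Finite ℚ (bettiCohomology (fiberOver 𝔉.u t) 2) := fun t => 𝔉.finite t 2
      IsHodgeGenericPoint 𝔉.u 2 𝔉.locallyTrivial 𝔉.isSmoothProjectiveFamily A hA ⟨𝔉.pt f, Set.mem_univ _⟩) :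
    let pmul : List ℕ → List ℕ → List ℕ := fun a b => (List.range (a.length + b.length - 1)).map fun k => ((List.range (k + 1)).map fun i => a.getD i 0 * b.getD (k - i) 0).sum; let ehn : ℕ → ℕ → ℕ → ℕ := fun p j q => if (q + 1) * p < 3 + j then 0 else ((List.replicate 3 (List.replicate (p - 1) 1)).foldl pmul [1]).getD ((q + 1) * p - 3 - j) 0; let Deck : (p : ℕ) → (X : SchemeOver ℂ) → IsSmoothProjective 2 X → (X ⟶ X) → Prop := fun p X hX σ => pull σ 2 ^ p = 1 ∧ (∀ x y, tr hX (2 + 2) (cup X 2 2 (pull σ 2 x) (pull σ 2 y)) = tr hX (2 + 2) (cup X 2 2 x y)) ∧ Module.finrank ℚ ↥(Module.End.eigenspace (pull σ 2) 1) = 1 ∧ ∃ ζ : ℂ, IsPrimitiveRoot ζ p ∧ ∀ j q : ℕ, 1 ≤ j → j < p → q ≤ 2 → Module.finrank ℂ ↥(Module.End.eigenspace ((pull σ 2).baseChange ℂ) (ζ ^ j) ⊓ (hodge exists_isReal_hodgeModel_holds hX 2).piece ((2 : ℤ) - q) q) = ehn p j q; let Uni : (X : SchemeOver ℂ) → IsSmoothProjective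 2 X → (X ⟶ X) → (bettiCohomology X 2 ≃ₗ[ℚ] bettiCohomology X 2) → Prop := fun X hX σ g => (∀ x, g (pull σ 2 x) = pull σ 2 (g x)) ∧ ∀ x y, tr hX (2 + 2) (cup X 2 2 (g x) (g y)) = tr hX (2 + 2) (cup X 2 2 x y); let Comm : (X : SchemeOver ℂ) → IsSmoothProjective 2 X → (X ⟶ X) → Prop := fun X hX σ => haveI := finite hX 2; haveI : HodgeTensorFacts.{0, 0} := hodgeTensorFacts_holds; ∀ g h : bettiCohomology X 2 ≃ₗ[ℚ] bettiCohomology X 2, Uni X hX σ g → Uni X hX σ h → g * h * g⁻¹ * h⁻¹ ∈ (hodge exists_isReal_hodgeModel_holds hX 2).hodgeGroup;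
    Deck p (SmoothHypersurface.hypersurface (MvPolynomial.X (Fin.last 3) ^ p - MvPolynomial.rename Fin.castSucc f)) hXF
        (diagonalAut (MvPolynomial.X (Fin.last 3) ^ p - MvPolynomial.rename Fin.castSucc f) ha) ∧
      Comm (SmoothHypersurface.hypersurface (MvPolynomial.X (Fin.last 3) ^ p - MvPolynomial.rename Fin.castSucc f)) hXF
        (diagonalAut (MvPolynomial.X (Fin.last 3) ^ p - MvPolynomial.rename Fin.castSucc f) ha) := by
  intro pmul ehn Deck Uni Comm
  haveI hHTF : HodgeTensorFacts.{0, 0} := hodgeTensorFacts_holds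
  haveI : ∀ t : ComplexPoints 𝔉.S, Module.Finite ℚ (bettiCohomology (fiberOver 𝔉.u t) 2) := fun t => 𝔉.finite t 2
  -- the deck clauses on the model: (o)–(ii) routine (landed), (iii)–(iv) from the PROVED print numbers
  obtain ⟨ha', h1, h2⟩ := exists_cyclicDeckModel_clauses_one_two hp.ne_zero f hXF
  obtain ⟨h3, h4⟩ := cyclicDeckHodge_of_printNumbers Arapura2012_hypersurface_geometricGenus_holds
    EisenbudHarris2016_surface_secondBettiNumber_holds hp h7 f hf hf0 hXF ha
  have h1' : pull (diagonalAut (MvPolynomial.X (Fin.last 3) ^ p - MvPolynomial.rename Fin.castSucc f) ha) 2 ^ p = 1 := by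
    rw [diagonalAut_congr _ ha ha' rfl]; exact h1
  have h2' : ∀ x y, tr hXF (2 + 2) (cup _ 2 2
      (pull (diagonalAut (MvPolynomial.X (Fin.last 3) ^ p - MvPolynomial.rename Fin.castSucc f) ha) 2 x)
      (pull (diagonalAut (MvPolynomial.X (Fin.last 3) ^ p - MvPolynomial.rename Fin.castSucc f) ha) 2 y)) =
      tr hXF (2 + 2) (cup _ 2 2 x y) := by
    rw [diagonalAut_congr _ ha ha' rfl]; exact h2
  refine ⟨⟨h1', h2', h3, h4⟩, ?_⟩
  intro g h hg hh
  -- the envelope kit of the fibre over the classifying point `s = pt f`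
  have hXF' : IsSmoothProjective 2 (SmoothHypersurface.hypersurface (cyclicCoverForm p f)) := hXF
  have haF : deckUnit p ∈ diagonalStabilizer (cyclicCoverForm p f) := ha
  obtain ⟨φ, B, hBs, hBn, τ, hτp, R, hτB, hφτ, hφB, hHG, hfix, hP1, hP2, hP3, hP4, hP5⟩ :=
    𝔉.exists_envelopeKit f hf hf0 hXF' haF exists_isReal_hodgeModel_holds hodgePQ_independent_of_hodgeModel_holds
      h1' h2' h3.le (A (𝔉.pt f)) (hA (𝔉.pt f))
  -- re-type `φ` on the route's spelling of the model (`cyclicCoverForm p f` unfolds to it)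
  obtain ⟨φ, rfl⟩ : ∃ φ' : bettiCohomology (fiberOver 𝔉.u (𝔉.pt f)) 2 ≃ₗ[ℚ]
      bettiCohomology (SmoothHypersurface.hypersurface
        (MvPolynomial.X (Fin.last 3) ^ p - MvPolynomial.rename Fin.castSucc f)) 2, φ' = φ := ⟨φ, rfl⟩
  haveI := finite hXF 2
  have hφτ' : ∀ x, φ (τ x) =
      pull (diagonalAut (MvPolynomial.X (Fin.last 3) ^ p - MvPolynomial.rename Fin.castSucc f) ha) 2 (φ x) := hφτ
  have hφB' : ∀ x y, B x y = tr hXF (2 + 2) (cup (SmoothHypersurface.hypersurface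
      (MvPolynomial.X (Fin.last 3) ^ p - MvPolynomial.rename Fin.castSucc f)) 2 2 (φ x) (φ y)) := hφB
  have hHG' : ∀ k : bettiCohomology (fiberOver 𝔉.u (𝔉.pt f)) 2 ≃ₗ[ℚ] bettiCohomology (fiberOver 𝔉.u (𝔉.pt f)) 2,
      k ∈ ((A (𝔉.pt f)).hodgeStructure (𝔉.isSmoothProjectiveFamily.isSmoothProjective (𝔉.pt f)) (hA (𝔉.pt f)) 2).hodgeGroup →
        (φ.symm.trans k).trans φ ∈ (hodge exists_isReal_hodgeModel_holds hXF 2).hodgeGroup := hHG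
  -- CMSP 15.3.7 (i), a THEOREM for this family: a finite-index subgroup `Γ'` of the monodromy group lies in
  -- `MT(H²(𝒴_s))` at the Hodge-generic point `s = pt f` — the hypothesis `hsgen` replaces the CDK cover here
  obtain ⟨Γ', hΓ'le, hΓ'fi, hΓ'MT⟩ := (deligne_finiteIndex_monodromy_le_mumfordTateGroup_of_isQuasiProjectiveOver 𝔉.u 2 2
    𝔉.isSmoothProjectiveFamily 𝔉.isQuasiProjectiveOver_total 𝔉.isQuasiProjectiveOver 𝔉.smooth 𝔉.irreducibleSpace
    𝔉.locallyTrivial A hA ⟨𝔉.pt f, Set.mem_univ _⟩ hsgen).1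
  -- transport the two σ-unitary automorphisms to the fibre
  have hστ : ∀ y, τ (φ.symm y) =
      φ.symm (pull (diagonalAut (MvPolynomial.X (Fin.last 3) ^ p - MvPolynomial.rename Fin.castSucc f) ha) 2 y) :=
    fun y => by
    apply φ.injective
    rw [hφτ', LinearEquiv.apply_symm_apply, LinearEquiv.apply_symm_apply]
  have cenτ : ∀ k : bettiCohomology (SmoothHypersurface.hypersurface
        (MvPolynomial.X (Fin.last 3) ^ p - MvPolynomial.rename Fin.castSucc f)) 2 ≃ₗ[ℚ]
      bettiCohomology (SmoothHypersurface.hypersurface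
        (MvPolynomial.X (Fin.last 3) ^ p - MvPolynomial.rename Fin.castSucc f)) 2,
      (∀ x, k (pull (diagonalAut (MvPolynomial.X (Fin.last 3) ^ p - MvPolynomial.rename Fin.castSucc f) ha) 2 x) =
        pull (diagonalAut (MvPolynomial.X (Fin.last 3) ^ p - MvPolynomial.rename Fin.castSucc f) ha) 2 (k x)) →
      ∀ x, ((φ.trans k).trans φ.symm) (τ x) = τ (((φ.trans k).trans φ.symm) x) := by
    intro k hk x
    simp only [LinearEquiv.trans_apply]
    rw [hφτ', hk, hστ]
  have cenB : ∀ k : bettiCohomology (SmoothHypersurface.hypersurface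
        (MvPolynomial.X (Fin.last 3) ^ p - MvPolynomial.rename Fin.castSucc f)) 2 ≃ₗ[ℚ]
      bettiCohomology (SmoothHypersurface.hypersurface
        (MvPolynomial.X (Fin.last 3) ^ p - MvPolynomial.rename Fin.castSucc f)) 2,
      (∀ x y, tr hXF (2 + 2) (cup (SmoothHypersurface.hypersurface
          (MvPolynomial.X (Fin.last 3) ^ p - MvPolynomial.rename Fin.castSucc f)) 2 2 (k x) (k y)) =
        tr hXF (2 + 2) (cup (SmoothHypersurface.hypersurface
          (MvPolynomial.X (Fin.last 3) ^ p - MvPolynomial.rename Fin.castSucc f)) 2 2 x y)) →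
      ∀ x y, B (((φ.trans k).trans φ.symm) x) (((φ.trans k).trans φ.symm) y) = B x y := by
    intro k hk x y
    simp only [LinearEquiv.trans_apply]
    rw [hφB', LinearEquiv.apply_symm_apply, LinearEquiv.apply_symm_apply, hk, ← hφB']
  -- B2: the commutator of the transported pair lies in the ℚ-Zariski closure of `⁅Γ', Γ'⁆` (PROVED density theorem)
  have hc : ((φ.trans g).trans φ.symm) * ((φ.trans h).trans φ.symm) * ((φ.trans g).trans φ.symm)⁻¹ *
      ((φ.trans h).trans φ.symm)⁻¹ ∈ glZariskiClosure ⁅Γ', Γ'⁆ :=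
    CyclicUnitaryPowersLaneDCommutatorClosure.unitaryReflectionDensity_of_CT71
      @carlsonToledo1999_unitaryReflection_zariskiDense_holds
      (bettiCohomology (fiberOver 𝔉.u (𝔉.pt f)) 2) B τ p R (ratMonodromyGroup 𝔉.u 2 𝔉.locallyTrivial ⟨𝔉.pt f, Set.mem_univ _⟩)
      hp h7 hBs hBn hτp hτB hfix hP1 hP2 hP3 hP4 hP5 Γ' hΓ'le hΓ'fi
      ((φ.trans g).trans φ.symm) ((φ.trans h).trans φ.symm) (cenτ g hg.1) (cenB g hg.2) (cenτ h hh.1) (cenB h hh.2)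
  -- B1 (landed, any weight): `(⁅Γ', Γ'⁆)^Zar(ℚ) ⊆ Hg` for `Γ' ≤ MT`, the fibre's Hodge structure being polarizable
  have hcomm := mem_hodgeGroup_of_mem_glZariskiClosure_commutator
    ((A (𝔉.pt f)).hodgeStructure (𝔉.isSmoothProjectiveFamily.isSmoothProjective (𝔉.pt f)) (hA (𝔉.pt f)) 2)
    (smoothProjective_hodgeStructure_isPolarizable_holds (𝔉.isSmoothProjectiveFamily.isSmoothProjective (𝔉.pt f))
      (A (𝔉.pt f)) (hA (𝔉.pt f)) 2) hΓ'MT hc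
  -- transport back to `H²(X_F;ℚ)` along `φ`
  have hback := hHG' _ hcomm
  have hid : (φ.symm.trans (((φ.trans g).trans φ.symm) * ((φ.trans h).trans φ.symm) * ((φ.trans g).trans φ.symm)⁻¹ *
      ((φ.trans h).trans φ.symm)⁻¹)).trans φ = g * h * g⁻¹ * h⁻¹ := by
    ext x
    simp only [LinearEquiv.mul_apply, LinearEquiv.trans_apply, LinearEquiv.coe_inv, LinearEquiv.symm_trans_apply,
      LinearEquiv.symm_symm, LinearEquiv.apply_symm_apply]
  rw [← hid]
  exact hback

/-! ### §2 Transfer to every surface cut out by `x₃^p − f`, and the Hodge conjecture on all its powers (fact-free) -/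

/-- **Deck transformation with `Deck ∧ Comm` on every `X` cut out by `x₃^p − f` at a Hodge-generic point** (fact-free):
the model statement `deck_comm_model_of_hodgeGeneric` carried along an isomorphism `e : X ≅ X_F`
(`IsHypersurfaceCutOutBy.nonempty_iso_hypersurface`) to `σ := e ≫ σ_F ≫ e⁻¹`, clause by clause
(`pull_conj_pow_eq_one_of_iso`, `tr_cup_pull_conj_of_iso`, `finrank_eigenspace_pull_conj_of_iso`,
`finrank_eigenspace_inf_piece_eq_of_iso`, `comm_of_iso` — the pointwise content of `stub_cyclicModelTransfer`).
[cite: CarlsonMullerStachPeters2017, Lemma–Definition 15.3.7] [cite: CarlsonToledo1999, §7 Theorem 7.1] -/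
theorem exists_deck_comm_of_hodgeGeneric {p : ℕ} (hp : p.Prime) (h7 : 7 ≤ p) (𝔉 : CarlsonToledoFamily p)
    (f : MvPolynomial (Fin 3) ℂ) (hf : f.IsHomogeneous p) (hf0 : f ≠ 0)
    (hXF : IsSmoothProjective 2 (SmoothHypersurface.hypersurface
      (MvPolynomial.X (Fin.last 3) ^ p - MvPolynomial.rename Fin.castSucc f)))
    (A : ∀ t : ComplexPoints 𝔉.S, HodgeModel 2 (fiberOver 𝔉.u t)) (hA : ∀ t, (A t).IsHodgeSymmetric)
    (hsgen : haveI : HodgeTensorFacts.{0, 0} := hodgeTensorFacts_holds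
      haveI : ∀ t : ComplexPoints 𝔉.S, Module.Finite ℚ (bettiCohomology (fiberOver 𝔉.u t) 2) := fun t => 𝔉.finite t 2
      IsHodgeGenericPoint 𝔉.u 2 𝔉.locallyTrivial 𝔉.isSmoothProjectiveFamily A hA ⟨𝔉.pt f, Set.mem_univ _⟩)
    ⦃X : SchemeOver ℂ⦄ (hX : IsSmoothProjective 2 X)
    (hcut : IsHypersurfaceCutOutBy 3 (MvPolynomial.X (Fin.last 3) ^ p - MvPolynomial.rename Fin.castSucc f) X) :
    let pmul : List ℕ → List ℕ → List ℕ := fun a b => (List.range (a.length + b.length - 1)).map fun k => ((List.range (k + 1)).map fun i => a.getD i 0 * b.getD (k - i) 0).sum; let ehn : ℕ → ℕ → ℕ → ℕ := fun p j q => if (q + 1) * p < 3 + j then 0 else ((List.replicate 3 (List.replicate (p - 1) 1)).foldl pmul [1]).getD ((q + 1) * p - 3 - j) 0; let Deck : (p : ℕ) → (X : SchemeOver ℂ) → IsSmoothProjective 2 X → (X ⟶ X) → Prop := fun p X hX σ => pull σ 2 ^ p = 1 ∧ (∀ x y, tr hX (2 + 2) (cup X 2 2 (pull σ 2 x) (pull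 σ 2 y)) = tr hX (2 + 2) (cup X 2 2 x y)) ∧ Module.finrank ℚ ↥(Module.End.eigenspace (pull σ 2) 1) = 1 ∧ ∃ ζ : ℂ, IsPrimitiveRoot ζ p ∧ ∀ j q : ℕ, 1 ≤ j → j < p → q ≤ 2 → Module.finrank ℂ ↥(Module.End.eigenspace ((pull σ 2).baseChange ℂ) (ζ ^ j) ⊓ (hodge exists_isReal_hodgeModel_holds hX 2).piece ((2 : ℤ) - q) q) = ehn p j q; let Uni : (X : SchemeOver ℂ) → IsSmoothProjective 2 X → (X ⟶ X) → (bettiCohomology X 2 ≃ₗ[ℚ] bettiCohomology X 2) → Prop := fun X hX σ g => (∀ x, g (pull σ 2 x) = pull σ 2 (g x)) ∧ ∀ x y, tr hX (2 + 2) (cup X 2 2 (g x) (g y)) = tr hX (2 + 2) (cup X 2 2 x y); let Comm : (X : SchemeOver ℂ) → IsSmoothProjective 2 X → (X ⟶ X) → Prop := fun X hX σ => haveI := finite hX 2; haveI : HodgeTensorFacts.{0, 0} := hodgeTensorFacts_holds; ∀ g h : bettiCohomology X 2 ≃ₗ[ℚ] bettiCohomology X 2, Uni X hX σ g → Uni X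 hX σ h → g * h * g⁻¹ * h⁻¹ ∈ (hodge exists_isReal_hodgeModel_holds hX 2).hodgeGroup;
    ∃ σ : X ⟶ X, Deck p X hX σ ∧ Comm X hX σ := by
  intro pmul ehn Deck Uni Comm
  obtain ⟨e⟩ := hcut.nonempty_iso_hypersurface
  have ha := rootUnits_mem_diagonalStabilizer hp.ne_zero f
  obtain ⟨hDeck, hComm⟩ := deck_comm_model_of_hodgeGeneric hp h7 𝔉 f hf hf0 hXF ha A hA hsgen
  dsimp only [Deck, Uni, Comm] at hDeck hComm ⊢
  obtain ⟨h1, h2, h3, ζ, hζ, h4⟩ := hDeck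
  refine ⟨e.hom ≫ diagonalAut _ ha ≫ e.inv, ⟨pull_conj_pow_eq_one_of_iso e h1,
    tr_cup_pull_conj_of_iso hX hXF e h2, ?_, ζ, hζ, fun j q hj hjp hq ↦ ?_⟩, ?_⟩
  · rw [finrank_eigenspace_pull_conj_of_iso]
    exact h3
  · rw [finrank_eigenspace_inf_piece_eq_of_iso exists_isReal_hodgeModel_holds
      hodgePQ_independent_of_hodgeModel_holds hX hXF e (diagonalAut _ ha) 2]
    exact h4 j q hj hjp hq
  · haveI : HodgeTensorFacts.{0, 0} := hodgeTensorFacts_holds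
    exact comm_of_iso exists_isReal_hodgeModel_holds hodgePQ_independent_of_hodgeModel_holds hX hXF e
      (diagonalAut _ ha) 2 hComm

/-- **The Hodge conjecture on every self fibre power of a HODGE-GENERIC smooth `p`-cyclic surface — fact-free core of
the rung-F-H1 leaf.**  For `p ≥ 7` prime, a Carlson–Toledo structure `𝔉`, a non-zero ternary `p`-form `f` whose
classifying point is Hodge generic (in some family of Hodge-symmetric models), every smooth projective surface `X` cut out
in `ℙ³` by `x₃^p − f`, and every `(k+1)`-fold self fibre power `Y` of `X`: `HodgeConjectureFor (2(k+1)) Y`.  Proof: the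
PROVED crux K2 `powersHodgeOfDeckCommutators` at the PROVED balancing `detSupportsBalanced_holds p`, fed with
`exists_deck_comm_of_hodgeGeneric`.  No Cattani–Deligne–Kaplan; no named fact; the only non-propositional input is the
structure `𝔉`.  [cite: CarlsonMullerStachPeters2017, Lemma–Definition 15.3.7] [cite: CarlsonToledo1999, §7 Theorem 7.1]
[cite: RamonMari2008, Thm. 3.3 (the K3 precedent of K2)] -/
theorem hodgeConjectureFor_powers_of_hodgeGeneric {p : ℕ} (hp : p.Prime) (h7 : 7 ≤ p) (𝔉 : CarlsonToledoFamily p)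
    (f : MvPolynomial (Fin 3) ℂ) (hf : f.IsHomogeneous p) (hf0 : f ≠ 0)
    (hXF : IsSmoothProjective 2 (SmoothHypersurface.hypersurface
      (MvPolynomial.X (Fin.last 3) ^ p - MvPolynomial.rename Fin.castSucc f)))
    (A : ∀ t : ComplexPoints 𝔉.S, HodgeModel 2 (fiberOver 𝔉.u t)) (hA : ∀ t, (A t).IsHodgeSymmetric)
    (hsgen : haveI : HodgeTensorFacts.{0, 0} := hodgeTensorFacts_holds
      haveI : ∀ t : ComplexPoints 𝔉.S, Module.Finite ℚ (bettiCohomology (fiberOver 𝔉.u t) 2) := fun t => 𝔉.finite t 2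
      IsHodgeGenericPoint 𝔉.u 2 𝔉.locallyTrivial 𝔉.isSmoothProjectiveFamily A hA ⟨𝔉.pt f, Set.mem_univ _⟩)
    ⦃X : SchemeOver ℂ⦄ (hX : IsSmoothProjective 2 X)
    (hcut : IsHypersurfaceCutOutBy 3 (MvPolynomial.X (Fin.last 3) ^ p - MvPolynomial.rename Fin.castSucc f) X)
    ⦃k : ℕ⦄ ⦃Y : SchemeOver ℂ⦄ (hY : ∃ π : Fin (k + 1) → (Y ⟶ X), Nonempty (IsLimit (Fan.mk Y π))) :
    HodgeConjectureFor (2 * (k + 1)) Y :=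
  CyclicUnitaryPowersPowersHodgeOfDeckCommutators.powersHodgeOfDeckCommutators hp h7
    (detSupportsBalanced_holds p h7) hX ⟨f, hf, hcut⟩
    (exists_deck_comm_of_hodgeGeneric hp h7 𝔉 f hf hf0 hXF A hA hsgen hX hcut) hY

/-! ### §3 The constructed family `cyclicCoverFamily p`: the same conclusions from F1‡ alone -/

/-- **K1-A's conclusion at every HODGE-GENERIC point of the constructed family, from F1‡ alone (no CDK).**  For `p ≥ 7`
prime and a non-zero ternary `p`-form `f` with smooth cyclic cover whose classifying point `cyclicCoverPoint p f` of the
constructed universal family `cyclicCoverFamily p` is Hodge generic (for some family of Hodge-symmetric Hodge models of the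
fibres), every smooth projective `X` cut out in `ℙ³` by `x₃^p − f` carries `σ : X ⟶ X` with the route's `Deck ∧ Comm`.
CONDITIONAL on F1‡ = `carlsonToledo1999_nodalMeridianLocalMonodromyBound` only.
[cite: CarlsonToledo1999, §2, §5, §6 (kdoublept), §7 Theorem 7.1] [cite: CarlsonMullerStachPeters2017, Lemma–Definition 15.3.7] -/
theorem exists_deck_comm_of_hodgeGeneric_of_localMonodromyBound
    (hF1 : carlsonToledo1999_nodalMeridianLocalMonodromyBound) {p : ℕ} [NeZero p] (hp : p.Prime) (h7 : 7 ≤ p)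
    (f : MvPolynomial (Fin 3) ℂ) (hf : f.IsHomogeneous p) (hf0 : f ≠ 0)
    (hXF : IsSmoothProjective 2 (SmoothHypersurface.hypersurface
      (MvPolynomial.X (Fin.last 3) ^ p - MvPolynomial.rename Fin.castSucc f)))
    (A : ∀ t : ComplexPoints (cyclicCoverBase p), HodgeModel 2 (fiberOver (cyclicCoverFamily p) t))
    (hA : ∀ t, (A t).IsHodgeSymmetric)
    (hsgen : haveI : HodgeTensorFacts.{0, 0} := hodgeTensorFacts_holds
      haveI : ∀ t : ComplexPoints (cyclicCoverBase p), Module.Finite ℚ (bettiCohomology (fiberOver (cyclicCoverFamily p) t) 2) :=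
        fun t => finite ((isSmoothProjectiveFamily_cyclicCoverFamily p).isSmoothProjective t) 2
      IsHodgeGenericPoint (cyclicCoverFamily p) 2 (cyclicCoverFamily_locallyTrivial p)
        (isSmoothProjectiveFamily_cyclicCoverFamily p) A hA ⟨cyclicCoverPoint p f, Set.mem_univ _⟩)
    ⦃X : SchemeOver ℂ⦄ (hX : IsSmoothProjective 2 X)
    (hcut : IsHypersurfaceCutOutBy 3 (MvPolynomial.X (Fin.last 3) ^ p - MvPolynomial.rename Fin.castSucc f) X) :
    let pmul : List ℕ → List ℕ → List ℕ := fun a b => (List.range (a.length + b.length - 1)).map fun k => ((List.range (k + 1)).map fun i => a.getD i 0 * b.getD (k - i) 0).sum; let ehn : ℕ → ℕ → ℕ → ℕ := fun p j q => if (q + 1) * p < 3 + j then 0 else ((List.replicate 3 (List.replicate (p - 1) 1)).foldl pmul [1]).getD ((q + 1) * p - 3 - j) 0; let Deck : (p : ℕ) → (X : SchemeOver ℂ) → IsSmoothProjective 2 X → (X ⟶ X) → Prop := fun p X hX σ => pull σ 2 ^ p = 1 ∧ (∀ x y, tr hX (2 + 2) (cup X 2 2 (pull σ 2 x) (pull σ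 2 y)) = tr hX (2 + 2) (cup X 2 2 x y)) ∧ Module.finrank ℚ ↥(Module.End.eigenspace (pull σ 2) 1) = 1 ∧ ∃ ζ : ℂ, IsPrimitiveRoot ζ p ∧ ∀ j q : ℕ, 1 ≤ j → j < p → q ≤ 2 → Module.finrank ℂ ↥(Module.End.eigenspace ((pull σ 2).baseChange ℂ) (ζ ^ j) ⊓ (hodge exists_isReal_hodgeModel_holds hX 2).piece ((2 : ℤ) - q) q) = ehn p j q; let Uni : (X : SchemeOver ℂ) → IsSmoothProjective 2 X → (X ⟶ X) → (bettiCohomology X 2 ≃ₗ[ℚ] bettiCohomology X 2) → Prop := fun X hX σ g => (∀ x, g (pull σ 2 x) = pull σ 2 (g x)) ∧ ∀ x y, tr hX (2 + 2) (cup X 2 2 (g x) (g y)) = tr hX (2 + 2) (cup X 2 2 x y); let Comm : (X : SchemeOver ℂ) → IsSmoothProjective 2 X → (X ⟶ X) → Prop := fun X hX σ => haveI := finite hX 2; haveI : HodgeTensorFacts.{0, 0} := hodgeTensorFacts_holds; ∀ g h : bettiCohomology X 2 ≃ₗ[ℚ] bettiCohomology X 2, Uni X hX σ g → Uni X hX σ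 h → g * h * g⁻¹ * h⁻¹ ∈ (hodge exists_isReal_hodgeModel_holds hX 2).hodgeGroup;
    ∃ σ : X ⟶ X, Deck p X hX σ ∧ Comm X hX σ := by
  -- the Carlson–Toledo structure ON `cyclicCoverFamily p` from F1‡ (and the theorem `b₂ = p³ − 4p² + 6p − 2`), built
  -- in place (fields as in `nonempty_carlsonToledoFamily_of_localMonodromyBound`) so that its family, transports and
  -- classifying map are the constructed ones definitionally and `hsgen` is Hodge-genericity in that structure
  have hp2 : 2 ≤ p := by omega
  have h := fun (g : MvPolynomial (Fin 3) ℂ) (hg : g.IsHomogeneous p) (hg0 : g ≠ 0)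
      (hXg : IsSmoothProjective 2 (SmoothHypersurface.hypersurface (cyclicCoverForm p g))) =>
    CyclicUnitaryPowersPLPackageOfLocalMonodromyBound.exists_cyclicReflectionSystem_of_localMonodromyBound hF1
      EisenbudHarris2016_surface_secondBettiNumber_holds hp h7 hg hg0 hXg
  exact exists_deck_comm_of_hodgeGeneric hp h7
    { Y := cyclicCoverTotal p
      S := cyclicCoverBase p
      u := cyclicCoverFamily p
      isSmoothProjectiveFamily := isSmoothProjectiveFamily_cyclicCoverFamily p
      isQuasiProjectiveOver := isQuasiProjectiveOver_baseSpz 2 p (cyclicCoverSpz p)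
      isQuasiProjectiveOver_total :=
        isQuasiProjectiveOver_totalSpz 2 p (cyclicCoverSpz p) (cyclicCoverSpz_surjective p (NeZero.ne p))
      smooth := smooth_baseSpz_hom ℂ 2 p (cyclicCoverSpz p)
      irreducibleSpace := irreducibleSpace_cyclicCoverBase p
      locallyTrivial := cyclicCoverFamily_locallyTrivial p
      pt := cyclicCoverPoint p
      exists_polynomials := cyclicCoverPoint_exists_polynomials p hp2
      pt_surjective := cyclicCoverPoint_surjective p hp2
      iso := fun g hg hg0 hXg => (h g hg hg0 hXg).choose
      deck := fun g hg hg0 hXg => (h g hg hg0 hXg).choose_spec.choose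
      pullEquiv_deck := fun g hg hg0 hXg ha x => (h g hg hg0 hXg).choose_spec.choose_spec.1 ha x
      system := fun g hg hg0 hXg => ((h g hg hg0 hXg).choose_spec.choose_spec.2).some }
    f hf hf0 hXF A hA hsgen hX hcut

/-- **The Hodge conjecture on all powers of every HODGE-GENERIC smooth `p`-cyclic surface, from F1‡ alone (no CDK)** —
the CDK-free twin of the rung-F-H1 leaf `CyclicSurfacePowersHodge` on the constructed family: for `p ≥ 7` prime, a
non-zero ternary `p`-form `f` with smooth cyclic cover whose classifying point `cyclicCoverPoint p f` of `cyclicCoverFamily p`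
is Hodge generic, every smooth projective `X ⊂ ℙ³` cut out by `x₃^p − f` and every `(k+1)`-fold self fibre power `Y` of `X`
satisfy `HodgeConjectureFor (2(k+1)) Y`.  CONDITIONAL on F1‡ = `carlsonToledo1999_nodalMeridianLocalMonodromyBound` ONLY
(crux K2 and support S are PROVED); Cattani–Deligne–Kaplan is NOT an input — it is needed only to pass from «Hodge
generic» to the polynomial «very general» of the typed leaf.  Rung F-H1 not moved; nothing here says HC ∕ HC_AV is proved.
[cite: CarlsonToledo1999, §2, §5, §6 (kdoublept), §7 Theorem 7.1] [cite: CarlsonMullerStachPeters2017, Lemma–Definition 15.3.7]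
[cite: RamonMari2008, Thm. 3.3 (the K3 precedent of K2)] -/
theorem hodgeConjectureFor_powers_of_hodgeGeneric_of_localMonodromyBound
    (hF1 : carlsonToledo1999_nodalMeridianLocalMonodromyBound) {p : ℕ} [NeZero p] (hp : p.Prime) (h7 : 7 ≤ p)
    (f : MvPolynomial (Fin 3) ℂ) (hf : f.IsHomogeneous p) (hf0 : f ≠ 0)
    (hXF : IsSmoothProjective 2 (SmoothHypersurface.hypersurface
      (MvPolynomial.X (Fin.last 3) ^ p - MvPolynomial.rename Fin.castSucc f)))
    (A : ∀ t : ComplexPoints (cyclicCoverBase p), HodgeModel 2 (fiberOver (cyclicCoverFamily p) t))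
    (hA : ∀ t, (A t).IsHodgeSymmetric)
    (hsgen : haveI : HodgeTensorFacts.{0, 0} := hodgeTensorFacts_holds
      haveI : ∀ t : ComplexPoints (cyclicCoverBase p), Module.Finite ℚ (bettiCohomology (fiberOver (cyclicCoverFamily p) t) 2) :=
        fun t => finite ((isSmoothProjectiveFamily_cyclicCoverFamily p).isSmoothProjective t) 2
      IsHodgeGenericPoint (cyclicCoverFamily p) 2 (cyclicCoverFamily_locallyTrivial p)
        (isSmoothProjectiveFamily_cyclicCoverFamily p) A hA ⟨cyclicCoverPoint p f, Set.mem_univ _⟩)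
    ⦃X : SchemeOver ℂ⦄ (hX : IsSmoothProjective 2 X)
    (hcut : IsHypersurfaceCutOutBy 3 (MvPolynomial.X (Fin.last 3) ^ p - MvPolynomial.rename Fin.castSucc f) X)
    ⦃k : ℕ⦄ ⦃Y : SchemeOver ℂ⦄ (hY : ∃ π : Fin (k + 1) → (Y ⟶ X), Nonempty (IsLimit (Fan.mk Y π))) :
    HodgeConjectureFor (2 * (k + 1)) Y :=
  CyclicUnitaryPowersPowersHodgeOfDeckCommutators.powersHodgeOfDeckCommutators hp h7
    (detSupportsBalanced_holds p h7) hX ⟨f, hf, hcut⟩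
    (exists_deck_comm_of_hodgeGeneric_of_localMonodromyBound hF1 hp h7 f hf hf0 hXF A hA hsgen hX hcut) hY

end Summit.HodgeConjecture.HodgeConjecture.Theorems.CyclicUnitaryPowersHodgeGenericDeckCommutators

end
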